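import Mathlib
import Summits.Ventures.HodgeRepro.Tier4.Common.MixedPlane
import Summits.Ventures.HodgeRepro.Tier4.Common.RowWeights

/-!
# Tier4/Line4/CMPlaceBridge — the real-CM-place binders of `kTypeData_seesaw` from the CM field itself

Blind re-derivation cell `pub-hodge-repro`, Tier 4 «PROVE THE STEP» (README §9–§10), LINE L4, seat t4-L3-p1 (gen 3),
re-pointed (R-19, lead S14934) to C-L4-KTYPEDATA-SEESAW (plan-4 S14857 (d)); first item = the two bridge lemmas of
crit-1's binder note S14901: the binders `hreal : ∀ w, w.IsReal` and `hcm : ∀ w, IsCMAt q w` of L4-p1 g4's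
`kTypeData_seesaw` are DERIVABLE when the base field is `k = E⁺ = maximalRealSubfield E` of the CM field `E`
(the line's `kOf E`, a skeleton abbrev) and `q` describes `E/k` (the line's `DescribesCM q`, a skeleton def — taken
here UNFOLDED: `∃ ω : E, ω² = t ω − n ∧ c(ω) = t − ω ∧ c(ω) ≠ ω`, so the skeleton's hypothesis feeds it by defeq).

* `isReal_of_kOf`: every infinite place of `E⁺` is real (Mathlib: `E⁺` is totally real, `IsTotallyReal.isReal`);
* `isCMAt_of_describesCM`: `IsCMAt q w` — `t_w² < 4 n_w` — at every (real) place `w` of `E⁺`: extend the embedding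
  `ψ_w : E⁺ → ℂ` of the place to `φ : E → ℂ` (`IsAlgClosed.lift`); `x := φ(ω)` satisfies `x² = a x − b` with
  `a = t_w`, `b = n_w` real, and `conj x = φ(c(ω)) = a − x` (`IsCMField.complexEmbedding_complexConj`); `x` real would
  give `φ(c(ω)) = φ(ω)`, i.e. `c(ω) = ω`; so `x.im ≠ 0`, whence `x.re = a/2` and `x.im² = b − a²/4 > 0`.

Imports: Mathlib and typer-2's `Common/MixedPlane` (`QuadData`), `Common/RowWeights` (`tAt`, `nAt`, `IsCMAt`,
`tAt_eq_re`, `nAt_eq_re`) by name.  `#print axioms` of both theorems = `[propext, Classical.choice, Quot.sound]`.  No printed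
input is consumed.  Nothing here asserts anything about the truth of (P); HC_CM is NOT proved by anyone in this
repository.
-/

set_option autoImplicit false

noncomputable section

namespace Summit.Ventures.HodgeRepro.Tier4.Line4

open Summit.Ventures.HodgeRepro.Tier4.Common NumberField
open scoped ComplexConjugate

/-- **Every infinite place of the maximal real subfield of a CM field is real** (the line's `kOf E` is
`↥(maximalRealSubfield E)`): the binder `hreal` of `kTypeData_seesaw`. -/
theorem isReal_of_kOf (E : Type) [Field E] [NumberField E] [IsCMField E]
    (w : InfinitePlace ↥(maximalRealSubfield E)) : w.IsReal :=
  IsTotallyReal.isReal w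

/-- **The CM condition at every place of `E⁺`** from `q` describing `E/E⁺` (the line's `DescribesCM q`, unfolded):
the binder `hcm` of `kTypeData_seesaw`. -/
theorem isCMAt_of_describesCM {E : Type} [Field E] [NumberField E] [IsCMField E]
    (q : QuadData ↥(maximalRealSubfield E))
    (hq : ∃ ω : E, ω ^ 2 = algebraMap ↥(maximalRealSubfield E) E q.t * ω - algebraMap ↥(maximalRealSubfield E) E q.n ∧
      IsCMField.complexConj E ω = algebraMap ↥(maximalRealSubfield E) E q.t - ω ∧ IsCMField.complexConj E ω ≠ ω)
    (w : InfinitePlace ↥(maximalRealSubfield E)) : IsCMAt q w := by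
  obtain ⟨ω, hω, hc, hne⟩ := hq
  have hw : w.IsReal := IsTotallyReal.isReal w
  -- the embedding of `E⁺` at `w`, extended to `E`
  letI : Algebra ↥(maximalRealSubfield E) ℂ :=
    ((InfinitePlace.Completion.extensionEmbedding w).comp (algebraMap ↥(maximalRealSubfield E) w.Completion)).toAlgebra
  haveI : Module.IsTorsionFree ↥(maximalRealSubfield E) ℂ := DivisionSemiring.to_moduleIsTorsionFree
  let φ : E →ₐ[↥(maximalRealSubfield E)] ℂ := IsAlgClosed.lift
  have h1 : φ (IsCMField.complexConj E ω) = conj (φ ω) :=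
    IsCMField.complexEmbedding_complexConj E (φ : E →+* ℂ) ω
  have hφk : ∀ x : ↥(maximalRealSubfield E), φ (algebraMap ↥(maximalRealSubfield E) E x) =
      InfinitePlace.Completion.extensionEmbedding w (algebraMap ↥(maximalRealSubfield E) w.Completion x) :=
    fun x => by rw [AlgHom.commutes]; rfl
  have ha : φ (algebraMap ↥(maximalRealSubfield E) E q.t) = tAt q w := hφk q.t
  have hb : φ (algebraMap ↥(maximalRealSubfield E) E q.n) = nAt q w := hφk q.n
  have hx2 : φ ω ^ 2 = tAt q w * φ ω - nAt q w := by
    have := congrArg φ hω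
    rwa [map_pow, map_sub, map_mul, ha, hb] at this
  have hconj : conj (φ ω) = tAt q w - φ ω := by
    have h2 := congrArg φ hc
    rw [map_sub, ha] at h2
    rw [← h1, h2]
  -- `x = φ ω` is not real
  have him : (φ ω).im ≠ 0 := by
    intro h0
    have hreal : conj (φ ω) = φ ω := by
      apply Complex.ext
      · simp
      · simp [h0]
    have h3 : φ (IsCMField.complexConj E ω) = φ ω := by
      rw [h1]
      exact hreal
    exact hne (φ.injective h3)
  -- real and imaginary parts
  rw [tAt_eq_re hw] at hx2 hconj
  rw [nAt_eq_re hw] at hx2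
  have hre : (φ ω).re = (tAt q w).re - (φ ω).re := by
    have := congrArg Complex.re hconj
    simpa using this
  have hre2 : (φ ω).re ^ 2 - (φ ω).im ^ 2 = (tAt q w).re * (φ ω).re - (nAt q w).re := by
    have := congrArg Complex.re hx2
    simpa [pow_two, Complex.mul_re, Complex.sub_re, Complex.ofReal_re, Complex.ofReal_im] using this
  have hpos : 0 < (φ ω).im ^ 2 := by positivity
  unfold IsCMAt
  nlinarith [hre, hre2, hpos]

end Summit.Ventures.HodgeRepro.Tier4.Line4

end
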